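import Literature.MathematicalPhysics.QuantumManyBody.LHYIntegrandBounds
import HarnessLib

/-!
# Perturbation of the Bogoliubov zero-point integrand `xG(y/x)` (FGJMOT Lemma 8.1, first part)

Topic `Literature/MathematicalPhysics/QuantumManyBody`, namespace `BoseGas` (provefact
`Literature.MathematicalPhysics.QuantumManyBody.BoseGas.Junge2026_neumannBox_pinnedLowerBound`; brick:
the two replacement estimates of the proof of [FournaisEtAl2024, Lemma 8.1] — `τ(p) ↦ p²`
("`|(τ(p) - p²)G(ρ_zĝ(p)/τ(p))| ≤ …`") and `ĝ(p) ↦ ĝ(0)`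
("`p²|G(ρ_zĝ(p)/τ(p)) - G(8πaρ_z/p²)| ≤ …`, where we used ... `|G'(t)| ≤ C(1+t)`") — in the
abstract form in which they are used: for the function `Φ(x, y) = xG(y/x)`,
`G(t) = √(1+2t) - 1 - t + t²/2` (so that `Φ(τ, ρ_zĝ) = √(τ² + 2ρ_zĝτ) - τ - ρ_zĝ + (ρ_zĝ)²/(2τ)`),

* `abs_lhyG_sub_lhyG_le` — `|G(t) - G(t')| ≤ max(t,t')·|t - t'|` (`0 ≤ G' ≤ t`);
* `abs_mul_lhyG_sub_mul_lhyG_le` — **`|xG(y/x) - x'G(y'/x')| ≤ |x - x'|(y/x)²/2 + x'·max(y/x, y'/x')·|y/x - y'/x'|`**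
  for `x, x' > 0`, `y, y' ≥ 0`;
* `mul_lhyG_le` — the tail bound `0 ≤ xG(y/x) ≤ y³/(2x²)` (`G ≤ t³/2`), the form of
  "`Σ_{|p|>Kℓ⁻¹} τG(ρ_zĝ/τ) ≤ CK_ℓ^{3/4}(ρa)³Σp⁻⁴`".

No definitions.

## References

* [FournaisEtAl2024] S. Fournais et al., arXiv:2408.14222, Ann. Henri Poincaré (2026): Lemma 8.1,
  proof (first three displays).
-/

noncomputable section

open Real Set

namespace Literature.MathematicalPhysics.QuantumManyBody.BoseGas

/-- **`|G(t) - G(t')| ≤ max(t, t')|t - t'|`** for `t, t' ≥ 0` (mean value theorem, `0 ≤ G' ≤ t`).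
[cite: FournaisEtAl2024, Lemma 8.1 (proof: "|G'(t)| ≤ C(1+t)")] -/
theorem abs_lhyG_sub_lhyG_le {t t' : ℝ} (ht : 0 ≤ t) (ht' : 0 ≤ t') :
    |(Real.sqrt (1 + 2 * t) - 1 - t + t ^ 2 / 2) - (Real.sqrt (1 + 2 * t') - 1 - t' + t' ^ 2 / 2)| ≤
      max t t' * |t - t'| := by
  -- reduce to `t' ≤ t`
  wlog h : t' ≤ t generalizing t t'
  · have := this ht' ht (le_of_not_ge h)
    rwa [abs_sub_comm, max_comm, abs_sub_comm (a := t')] at this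
  set G : ℝ → ℝ := fun u => Real.sqrt (1 + 2 * u) - 1 - u + u ^ 2 / 2 with hG
  have hderiv : ∀ u ∈ Icc t' t, HasDerivWithinAt G ((Real.sqrt (1 + 2 * u))⁻¹ - 1 + u) (Icc t' t) u :=
    fun u hu => (hasDerivAt_lhyG (ht'.trans hu.1)).hasDerivWithinAt
  have hbound : ∀ u ∈ Ico t' t, ‖(Real.sqrt (1 + 2 * u))⁻¹ - 1 + u‖ ≤ t := by
    intro u hu
    have hu0 : 0 ≤ u := ht'.trans hu.1
    rw [Real.norm_eq_abs, abs_of_nonneg (lhyG_deriv_nonneg hu0)]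
    exact (lhyG_deriv_le hu0).trans hu.2.le
  have hmvt := norm_image_sub_le_of_norm_deriv_le_segment' hderiv hbound t (right_mem_Icc.2 h)
  rw [Real.norm_eq_abs] at hmvt
  show |G t - G t'| ≤ max t t' * |t - t'|
  rw [max_eq_left h, abs_of_nonneg (sub_nonneg.2 h)]
  calc |G t - G t'| ≤ t * (t - t') := hmvt
    _ = t * (t - t') := rfl

/-- **The replacement estimate for `Φ(x,y) = xG(y/x)`**:
`|xG(y/x) - x'G(y'/x')| ≤ |x - x'|·(y/x)²/2 + x'·max(y/x, y'/x')·|y/x - y'/x'|` for `x, x' > 0`,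
`y, y' ≥ 0` (`G ≤ t²/2` for the prefactor, the mean value theorem for the argument) — the form of
the two estimates "`|(τ - p²)G(ρ_zĝ/τ)|`" and "`p²|G(ρ_zĝ/τ) - G(8πaρ_z/p²)|`" of the paper.
[cite: FournaisEtAl2024, Lemma 8.1 (proof, third display)] -/
theorem abs_mul_lhyG_sub_mul_lhyG_le {x x' y y' : ℝ} (hx : 0 < x) (hx' : 0 < x') (hy : 0 ≤ y)
    (hy' : 0 ≤ y') :
    |x * (Real.sqrt (1 + 2 * (y / x)) - 1 - y / x + (y / x) ^ 2 / 2) -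
        x' * (Real.sqrt (1 + 2 * (y' / x')) - 1 - y' / x' + (y' / x') ^ 2 / 2)| ≤
      |x - x'| * ((y / x) ^ 2 / 2) + x' * (max (y / x) (y' / x') * |y / x - y' / x'|) := by
  set t : ℝ := y / x with ht
  set t' : ℝ := y' / x' with ht'
  have ht0 : 0 ≤ t := div_nonneg hy hx.le
  have ht'0 : 0 ≤ t' := div_nonneg hy' hx'.le
  set G : ℝ → ℝ := fun u => Real.sqrt (1 + 2 * u) - 1 - u + u ^ 2 / 2 with hG
  have hG0 : 0 ≤ G t := lhyG_nonneg ht0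
  have hG2 : G t ≤ t ^ 2 / 2 := lhyG_le_half_sq ht0
  have hsplit : x * G t - x' * G t' = (x - x') * G t + x' * (G t - G t') := by ring
  show |x * G t - x' * G t'| ≤ |x - x'| * (t ^ 2 / 2) + x' * (max t t' * |t - t'|)
  rw [hsplit]
  calc |(x - x') * G t + x' * (G t - G t')| ≤ |(x - x') * G t| + |x' * (G t - G t')| := abs_add_le _ _
    _ = |x - x'| * G t + x' * |G t - G t'| := by
        rw [abs_mul, abs_of_nonneg hG0, abs_mul, abs_of_pos hx']
    _ ≤ |x - x'| * (t ^ 2 / 2) + x' * (max t t' * |t - t'|) :=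
        add_le_add (mul_le_mul_of_nonneg_left hG2 (abs_nonneg _))
          (mul_le_mul_of_nonneg_left (abs_lhyG_sub_lhyG_le ht0 ht'0) hx'.le)

/-- **The tail bound** `0 ≤ xG(y/x) ≤ y³/(2x²)` for `x > 0`, `y ≥ 0` (`0 ≤ G(t) ≤ t³/2`).
[cite: FournaisEtAl2024, Lemma 8.1 (proof, second display: "Using that G(t) ≤ Ct³")] -/
theorem mul_lhyG_le {x y : ℝ} (hx : 0 < x) (hy : 0 ≤ y) :
    0 ≤ x * (Real.sqrt (1 + 2 * (y / x)) - 1 - y / x + (y / x) ^ 2 / 2) ∧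
      x * (Real.sqrt (1 + 2 * (y / x)) - 1 - y / x + (y / x) ^ 2 / 2) ≤ y ^ 3 / (2 * x ^ 2) := by
  have ht0 : 0 ≤ y / x := div_nonneg hy hx.le
  refine ⟨mul_nonneg hx.le (lhyG_nonneg ht0), ?_⟩
  calc x * (Real.sqrt (1 + 2 * (y / x)) - 1 - y / x + (y / x) ^ 2 / 2) ≤ x * ((y / x) ^ 3 / 2) :=
        mul_le_mul_of_nonneg_left (lhyG_le_half_cube ht0) hx.le
    _ = y ^ 3 / (2 * x ^ 2) := by field_simp

/-- **`Φ(x, y) = xG(y/x)` is the Bogoliubov zero-point integrand**: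
`xG(y/x) = √(x² + 2xy) - x - y + y²/(2x)` for `x > 0`, `y ≥ 0`. [cite: FournaisEtAl2024, Lemma 8.1 (proof: "xG(y/x) = √(x²+2xy) - x - y …")] -/
theorem mul_lhyG_eq {x y : ℝ} (hx : 0 < x) (hy : 0 ≤ y) :
    x * (Real.sqrt (1 + 2 * (y / x)) - 1 - y / x + (y / x) ^ 2 / 2) =
      Real.sqrt (x ^ 2 + 2 * x * y) - x - y + y ^ 2 / (2 * x) := by
  have h1 : Real.sqrt (x ^ 2 + 2 * x * y) = x * Real.sqrt (1 + 2 * (y / x)) := by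
    rw [← Real.sqrt_sq hx.le, ← Real.sqrt_mul (sq_nonneg x), Real.sqrt_sq hx.le]
    congr 1
    field_simp
  rw [h1]
  field_simp

end Literature.MathematicalPhysics.QuantumManyBody.BoseGas
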